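import Summits.Ventures.HSemireg.WedgeWeilCarrierRank
import Summits.Ventures.HSemireg.ContractionRankPointPairBox
import Summits.Ventures.HSemireg.ContractionSpanKunnethFactors
import HarnessLib

/-!
# Venture HSemireg — `contractionRank` of a WEIL-FRAME class on the REAL carriers:
# `r(A, κ) = (4 + ρ)n² - 2n` (`dim A = 2n`, `n ≥ 3`, `ρ` = Hankel rank of the h-part) — THEOREM R (STRUCTURE.md D9 /
# FORMULA-N (F1) Weil-frame clause) in the frame of `PerfectComplexRankDoor.lean`

HONEST FRAMING. The end-to-end form of th-7's THEOREM R (`theory/FORMULA-N-th7.md` PART B §L.3 / §N.4 / §N.5 / §N.12,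
kernel files `WedgeWeil*.lean`) on the carriers of `PerfectComplexRankDoor.lean` (seat p4 of the computation cell
`pub-hsemireg`): `WedgeWeilCarrier.lean` instantiated at `V = H¹(A(ℂ); ℂ)` (`complexBetti A.X 1`), `L = H^{0,1}` (the tree's
`hodgeZeroOne`, carrier `hodgeZeroOneSet A`), `Θ = vectorFieldSet A = L^⊥`.  THE WEIL FRAME IS AN INPUT, STATED BY VALUE
(th-7: «the identification of a geometric class-exact vector with `(q; a, b)` in an adapted Weil frame is the non-Lean input»):
an ADAPTED BASIS `bV` of `H¹(A)` indexed by `Fin (2n + 2n)` whose first `2n` vectors span `H^{0,1}(A)` (`hL`), and the identity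
`totalExteriorClass A κ = Ecl bV q (2n) + a·w₊ + b·w₋` (`hx`) — `Ecl` the `q`-weighted divided powers of `Θ = Σ_a ℓ_a ∧ m_a`
(«`Σ_m q_m h^m/m!`», the `ℚ[h]`-part of `κ`), `w₊ = wUp bV n`, `w₋ = wLow bV n` the top forms of the two adapted blocks
(«`det H¹_+`, `det H¹_-`, the two complex Weil vectors spanning `W_K ⊗ ℂ`»).  On a Weil-type abelian `2n`-fold these are the
data of FORMULA-N PART B §L (the `K`-eigenspace splitting of `H¹`, the polarisation, the Weil plane); the tree has no
Weil-type-abelian-variety structure theory deriving them, so nothing here DERIVES this shape for an explicit variety — a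
consumer supplies it, exactly as for `ContractionRankPointPairBox.lean`.  The last section does the same for the h-part ALONE
(THEOREM H / C15 of th-7, enclosed by p3 as `WedgeC15General` / `WedgeC15Laws`).  Nothing here is a claim about any explicit variety;
nothing here says that HC / HC_CM / HC_AV holds.  Everything PROVED; no named fact.
-/

noncomputable section

open Module
open Literature.AlgebraicGeometry.Motives Literature.AlgebraicGeometry.HodgeTheory

namespace Summit.Ventures.HSemireg

variable {A : AbelianVariety ℂ}

/-- **THEOREM R on the real carriers (Weil type `(n, n)`, `n ≥ 3`):** if `H¹(A)` has an adapted basis `bV` (indexed by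
`Fin (2n + 2n)`) whose first half spans `H^{0,1}(A)`, and the total class of `κ` in `Λ H¹(A)` is
`Ecl bV q (2n) + a·w₊ + b·w₋` with `a, b ≠ 0` (h-part of Hankel rank `ρ = rank H₂(q)` plus a two-sided Weil part), then
`contractionRank A κ = 4n² + n²·ρ - 2n = (4 + ρ)n² - 2n` (e.g. `48` for `n = 3`, `ρ = 2`: the census' theta-secant /
secant sixfold objects).  The `n = 2` rows are outside `3 ≤ n` (purity coincidence, FORMULA-N PART B §L.5).
[cite: BuchweitzFlenner2008HH, Prop. 6.4.4] [cite: MumfordAV1970, §1 (4) and §4 (iii)] -/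
theorem contractionRank_weil (hA : IsSmoothProjective A.dim A.X) (κ : ∀ p : ℕ, complexBetti A.X (2 * p)) {n : ℕ}
    (hn : 3 ≤ n) (bV : Basis (Fin (n + n + (n + n))) ℂ (complexBetti A.X 1))
    (hL : hodgeZeroOne hA = WedgeBridge.Lsp bV) (q : ℕ → ℂ) {a b : ℂ} (ha : a ≠ 0) (hb : b ≠ 0)
    (hx : totalExteriorClass A κ =
      WedgeBridge.Ecl bV q (n + n) + a • WeilCarrier.wUp bV n + b • WeilCarrier.wLow bV n) :
    contractionRank A κ =
      ((4 * (n * n) + n * n * (Wedge.Hankel.hankel1 ℂ (n + n) 2 q).rank - 2 * n : ℕ) : Cardinal) := by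
  haveI : Module.Finite ℂ (complexBetti A.X 1) := abelianVarietyCohomologyExteriorH1_holds.finite_one A
  have h := WeilCarrier.finrank_contractionSpan_weil_nn bV hn q ha hb
  rw [contractionRank_eq_finrank_span, hx, vectorFieldSet_eq A hA rfl, ← coe_hodgeZeroOne_eq_hodgeZeroOneSet A hA rfl,
    hL, ← ContractionSpan.coe_dualAnnihilator_eq]
  have h' : Module.finrank ℂ (ContractionSpan.span (WedgeBridge.Lsp bV : Set (complexBetti A.X 1))
      ((WedgeBridge.Lsp bV).dualAnnihilator : Set (Module.Dual ℂ (complexBetti A.X 1)))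
      (WedgeBridge.Ecl bV q (n + n) + a • WeilCarrier.wUp bV n + b • WeilCarrier.wLow bV n)) =
      4 * (n * n) + n * n * (Wedge.Hankel.hankel1 ℂ (n + n) 2 q).rank - 2 * n := by
    omega
  rw [h']

/-- **THEOREM R on the real carriers, general signature `(p, N - p)`, `3 ≤ N - p`:** with an adapted basis `bV` of
`H¹(A)` indexed by `Fin (N + N)` (first `N` vectors spanning `H^{0,1}(A)`) and
`totalExteriorClass A κ = Ecl bV q N + a·wUp bV p + b·wLow bV p`, `a b ≠ 0`:
`contractionRank A κ = C(2N, 2) + p(N - p)·rank H₂(q) - 2p·2(N - p)`.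
[cite: BuchweitzFlenner2008HH, Prop. 6.4.4] [cite: MumfordAV1970, §1 (4) and §4 (iii)] -/
theorem contractionRank_weil_signature (hA : IsSmoothProjective A.dim A.X) (κ : ∀ p : ℕ, complexBetti A.X (2 * p))
    {N p : ℕ} (hNp : 3 ≤ N - p) (bV : Basis (Fin (N + N)) ℂ (complexBetti A.X 1))
    (hL : hodgeZeroOne hA = WedgeBridge.Lsp bV) (q : ℕ → ℂ) {a b : ℂ} (ha : a ≠ 0) (hb : b ≠ 0)
    (hx : totalExteriorClass A κ =
      WedgeBridge.Ecl bV q N + a • WeilCarrier.wUp bV p + b • WeilCarrier.wLow bV p) :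
    contractionRank A κ =
      (((N + N).choose 2 + p * (N - p) * (Wedge.Hankel.hankel1 ℂ N 2 q).rank - (p + p) * ((N + N) - (p + p)) : ℕ) :
        Cardinal) := by
  haveI : Module.Finite ℂ (complexBetti A.X 1) := abelianVarietyCohomologyExteriorH1_holds.finite_one A
  have h := WeilCarrier.finrank_contractionSpan_weil bV hNp q ha hb
  rw [contractionRank_eq_finrank_span, hx, vectorFieldSet_eq A hA rfl, ← coe_hodgeZeroOne_eq_hodgeZeroOneSet A hA rfl,
    hL, ← ContractionSpan.coe_dualAnnihilator_eq]
  have h' : Module.finrank ℂ (ContractionSpan.span (WedgeBridge.Lsp bV : Set (complexBetti A.X 1))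
      ((WedgeBridge.Lsp bV).dualAnnihilator : Set (Module.Dual ℂ (complexBetti A.X 1)))
      (WedgeBridge.Ecl bV q N + a • WeilCarrier.wUp bV p + b • WeilCarrier.wLow bV p)) =
      (N + N).choose 2 + p * (N - p) * (Wedge.Hankel.hankel1 ℂ N 2 q).rank - (p + p) * ((N + N) - (p + p)) := by
    omega
  rw [h']

/-- **THEOREM R at `ρ = 2` (two-ended h-part `f = c₀·1 + c_N·Θ^{2n}/(2n)!`, i.e. «`c₀ + c_N·pt`»): `r = 6n² - 2n`** (`n ≥ 3`) — the
four-term class `c₀·1 + c_N·pt + a·w₊ + b·w₋` with all coefficients non-zero, decomposable (a box, `c₀c_N ∝ ab`) OR NOT; the same number as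
p4 gen 2's point-pair box `contractionRank_pointPairBox` and th-7's `BoxRank`. [cite: BuchweitzFlenner2008HH, Prop. 6.4.4] -/
theorem contractionRank_weil_twoEnded (hA : IsSmoothProjective A.dim A.X) (κ : ∀ p : ℕ, complexBetti A.X (2 * p)) {n : ℕ}
    (hn : 3 ≤ n) (bV : Basis (Fin (n + n + (n + n))) ℂ (complexBetti A.X 1))
    (hL : hodgeZeroOne hA = WedgeBridge.Lsp bV) {c₀ cN a b : ℂ} (hc₀ : c₀ ≠ 0) (hcN : cN ≠ 0) (ha : a ≠ 0) (hb : b ≠ 0)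
    (hx : totalExteriorClass A κ =
      WedgeBridge.Ecl bV (fun m => (if m = 0 then c₀ else 0) + (if m = n + n then cN else 0)) (n + n) +
        a • WeilCarrier.wUp bV n + b • WeilCarrier.wLow bV n) :
    contractionRank A κ = ((6 * (n * n) - 2 * n : ℕ) : Cardinal) := by
  rw [contractionRank_weil hA κ hn bV hL _ ha hb hx,
    WedgeC15.hankel1_rank_twoEnded hc₀ hcN (k := 2) (by omega) (by omega)]
  congr 2
  ring

/-- **the same with the h-part WRITTEN OUT:** total class `c₀·1 + c_N·(ℓ_{2n-1} ∧ m_{2n-1}) ⋯ (ℓ_0 ∧ m_0) + a·w₊ + b·w₋` («`c₀ + c_N·pt +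
a·w₊ + b·w₋`», all four coefficients non-zero, `n ≥ 3`) ⟹ `contractionRank A κ = 6n² - 2n`.
[cite: BuchweitzFlenner2008HH, Prop. 6.4.4] [cite: MumfordAV1970, §1 (4) and §4 (iii)] -/
theorem contractionRank_weil_fourTerm (hA : IsSmoothProjective A.dim A.X) (κ : ∀ p : ℕ, complexBetti A.X (2 * p)) {n : ℕ}
    (hn : 3 ≤ n) (bV : Basis (Fin (n + n + (n + n))) ℂ (complexBetti A.X 1))
    (hL : hodgeZeroOne hA = WedgeBridge.Lsp bV) {c₀ cN a b : ℂ} (hc₀ : c₀ ≠ 0) (hcN : cN ≠ 0) (ha : a ≠ 0) (hb : b ≠ 0)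
    (hx : totalExteriorClass A κ =
      algebraMap ℂ _ c₀ + cN • WeilCarrier.LMprod bV (n + n) + a • WeilCarrier.wUp bV n + b • WeilCarrier.wLow bV n) :
    contractionRank A κ = ((6 * (n * n) - 2 * n : ℕ) : Cardinal) := by
  rw [← WeilCarrier.Ecl_twoEnded] at hx
  exact contractionRank_weil_twoEnded hA κ hn bV hL hc₀ hcN ha hb hx

/-! ### THEOREM H / C15 on the real carriers (the h-part alone; FORMULA-N PART A §2.6, PART B §N.9–N.11) -/

/-- **THEOREM H on the real carriers (EVERY coefficient sequence):** if `H¹(A)` has an adapted basis `bV` (indexed by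
`Fin (n + n)`) whose first half spans `H^{0,1}(A)`, and the total class of `κ` is the `q`-weighted divided-power class
`Ecl bV q n` (`= Σ_m q_m h^m/m!` for the adapted `h = Σ_a ℓ_a ∧ m_a`), then `contractionRank A κ = C(n,2) · rank H₂(q)`
(th-7's `hankelLaw_model` in degree `2`, carried by p3's enclosure `WedgeC15General.finrank_contractionSpan_Ecl_eq_hankel`).
[cite: BuchweitzFlenner2008HH, Prop. 6.4.4] [cite: MumfordAV1970, §1 (4) and §4 (iii)] -/
theorem contractionRank_hankel (hA : IsSmoothProjective A.dim A.X) (κ : ∀ p : ℕ, complexBetti A.X (2 * p)) {n : ℕ}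
    (bV : Basis (Fin (n + n)) ℂ (complexBetti A.X 1)) (hL : hodgeZeroOne hA = WedgeBridge.Lsp bV) (q : ℕ → ℂ)
    (hx : totalExteriorClass A κ = WedgeBridge.Ecl bV q n) :
    contractionRank A κ = ((n.choose 2 * (Wedge.Hankel.hankel1 ℂ n 2 q).rank : ℕ) : Cardinal) := by
  haveI : Module.Finite ℂ (complexBetti A.X 1) := abelianVarietyCohomologyExteriorH1_holds.finite_one A
  rw [contractionRank_eq_finrank_span, hx, vectorFieldSet_eq A hA rfl, ← coe_hodgeZeroOne_eq_hodgeZeroOneSet A hA rfl,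
    hL, ← ContractionSpan.coe_dualAnnihilator_eq, WedgeC15.finrank_contractionSpan_Ecl_eq_hankel]

/-- **C15 on the real carriers (finite exponential sums):** with the adapted basis as above and the total class
`Σ_i c_i · exp(λ_i h) = Σ_i c_i · Eprod bV λ_i n`, `contractionRank A κ = C(n,2) · rank H₂(q)` for `q_m = Σ_i c_i λ_i^m`
(p3's enclosure `WedgeC15Laws.finrank_contractionSpan_expSum_eq_hankel`). [cite: BuchweitzFlenner2008HH, Prop. 6.4.4] -/
theorem contractionRank_expSum (hA : IsSmoothProjective A.dim A.X) (κ : ∀ p : ℕ, complexBetti A.X (2 * p)) {n : ℕ}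
    (bV : Basis (Fin (n + n)) ℂ (complexBetti A.X 1)) (hL : hodgeZeroOne hA = WedgeBridge.Lsp bV)
    {ι' : Type*} (s : Finset ι') (c lam : ι' → ℂ)
    (hx : totalExteriorClass A κ = ∑ i ∈ s, c i • WedgeBridge.Eprod bV (lam i) n) :
    contractionRank A κ =
      ((n.choose 2 * (Wedge.Hankel.hankel1 ℂ n 2 (fun m => ∑ i ∈ s, c i * lam i ^ m)).rank : ℕ) : Cardinal) := by
  haveI : Module.Finite ℂ (complexBetti A.X 1) := abelianVarietyCohomologyExteriorH1_holds.finite_one A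
  rw [contractionRank_eq_finrank_span, hx, vectorFieldSet_eq A hA rfl, ← coe_hodgeZeroOne_eq_hodgeZeroOneSet A hA rfl,
    hL, ← ContractionSpan.coe_dualAnnihilator_eq, WedgeC15.finrank_contractionSpan_expSum_eq_hankel]

end Summit.Ventures.HSemireg

end
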